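/-
Copyright (c) 2026 the pub-hodgecm-mathlib formalisation cell (harness21).  Prover seat hodgecm-mathlib-K2E5-p17 (g0),
Track B «K2-LIT» ∕ h413, engine E5 «TamagawaUnitary», unit HAAR-FIBRATION (generic calculus), helper for socket F8β
`K2E5TamagawaUnitary.SUMeasure.sig_K2E5SUPinnedEqSmulBeta`: PINS ARE TRANSPORTED ALONG A COMMUTING SQUARE OF TOPOLOGICAL-GROUP ISOMORPHISMS.
2026-09-03.
-/
import Literature.MeasureTheory.Group.InvariantQuotientTransport                    -- ★ `cosetCongr`, `subgroupCongrHomeomorph`, `map_cosetCongr_quotientMeasure` (naturality of `quotientMeasure`)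
import Summits.HodgeConjecture.HodgeConjecture.Theorems.K2E5HaarKerLiftHomeomorph   -- ★ A2 (p854944): `continuous_kerLift`
import HarnessLib

/-!
# K2 ∕ E5 «TamagawaUnitary», unit HAAR-FIBRATION — helper `haarPinTransport`: a pin `(kerLift φ)_* (μ ∕ ρ) = ν` is carried by a commuting square
# of topological-group isomorphisms `(Φ, Ψ)` to the pin `(kerLift φ')_* (Φ_* μ ∕ (Φ|_{ker})_* ρ) = Ψ_* ν`

Cell `pub/hodgecm-mathlib` (D-0151), Track B, dealer K2E5-plan DEALS E5 BATCH #6 (2026-09-03T22:51:15Z (a): F8β head to K2E5-p17); this file is step (4) «S1» of the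
REPORT-FIRST plan for F8β (`K2/STATUS.md` 2026-09-03T22:54Z): the generic engine that moves the product pin of ★ A9 `haarPinProd` (on
`U(h)(L ⊗ ℝ) × U(h)(𝔸_f) → U(1)_∞ × U(1)(𝔸_f)`) to the adelic det-fibration `detU : U(h)(𝔸) → U(1)(𝔸)` along ★ #3b's SQUARE `detU ∘ subgroupCongr ∘ e = adelicDet (1) ∘ e₁ ∘
(archDetU × finDetU)`.  Item `stmt-HodgeConjecture-24833`, route of record `route-HodgeConjecture-HCCMUnconditional`.

THE MATHEMATICS ([DeitmarEchterhoff2014, Thm. 1.5.3]: the invariant quotient measure with Weil constant one is CANONICAL, hence natural under isomorphisms;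
[VignerasLNM800, Ch. II §4 «mesures compatibles»]).  Setting: `φ : G →* Q`, `φ' : G' →* Q'` continuous homomorphisms of topological groups with closed kernels (`G`, `G'`
locally compact, second countable, Hausdorff), `Φ : G ≃* G'` a homeomorphic isomorphism and `Ψ : Q ≃* Q'` an isomorphism with `Ψ` continuous, forming a COMMUTING SQUARE
`φ' ∘ Φ = Ψ ∘ φ`.  Then `Φ(ker φ) = ker φ'` (`forall_map_mem_ker_iff`), the induced map of coset spaces satisfies `kerLift φ' ∘ cosetCongr Φ = Ψ ∘ kerLift φ`
(`kerLift_cosetCongr`), and for Haar-type `μ` on `G`, `ρ` on `ker φ` with images `μ' = Φ_* μ`, `ρ' = (Φ|_{ker φ})_* ρ`, ★ naturality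
`(cosetCongr Φ)_* (μ ∕ ρ) = μ' ∕ ρ'` gives **`haarPinTransport`**: `(kerLift φ)_* (μ ∕ ρ) = ν ⟹ (kerLift φ')_* (μ' ∕ ρ') = Ψ_* ν`.
Mathlib + ★ only; no `def`.

HONEST LABEL.  HC_CM is proved only modulo the 7 printed citations (2 remaining named inputs: hLiu418 = `stmt-HodgeConjecture-24832`, h413 =
`stmt-HodgeConjecture-24833`) until rung 0 closes; this file is a `--supports stmt-HodgeConjecture-24833 --as helper` leaf and moves no counter.

## References
* [DeitmarEchterhoff2014] A. Deitmar, S. Echterhoff, *Principles of Harmonic Analysis*, 2nd ed., Springer (2014) — Thm. 1.5.3 (quotient integral formula; uniqueness).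
* [VignerasLNM800] M.-F. Vignéras, *Arithmétique des algèbres de quaternions*, LNM 800 (1980) — Ch. II §4 («mesures compatibles» along exact sequences, local and global).
-/

set_option autoImplicit false
-- the mandated namespace repeats the single-problem summit's segment (`HodgeConjecture.HodgeConjecture`)
set_option linter.dupNamespace false

noncomputable section

namespace Summit.HodgeConjecture.HodgeConjecture.Cruxes.H413.K2E5HaarPinTransport

open MeasureTheory MeasureTheory.Measure Topology
open Literature.MeasureTheory.Group
open scoped ENNReal

section Square

variable {G G' Q Q' : Type*} [Group G] [Group G'] [Group Q] [Group Q']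
  (φ : G →* Q) (φ' : G' →* Q') (Φ : G ≃* G') (Ψ : Q ≃* Q') (hsq : ∀ g, φ' (Φ g) = Ψ (φ g))

include hsq in
/-- In a commuting square `φ' ∘ Φ = Ψ ∘ φ` with `Ψ` injective on `1`, `Φ` carries `ker φ` onto `ker φ'`: `Φ g ∈ ker φ' ↔ g ∈ ker φ`. [folklore] -/
theorem forall_map_mem_ker_iff : ∀ g, Φ g ∈ φ'.ker ↔ g ∈ φ.ker := fun g => by
  rw [MonoidHom.mem_ker, MonoidHom.mem_ker, hsq, map_eq_one_iff Ψ Ψ.injective]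

include hsq in
/-- The induced map of coset spaces intertwines the two `kerLift`s: `kerLift φ' (cosetCongr Φ x) = Ψ (kerLift φ x)`. [folklore] -/
theorem kerLift_cosetCongr (x : G ⧸ φ.ker) :
    QuotientGroup.kerLift φ' (cosetCongr Φ φ.ker φ'.ker (forall_map_mem_ker_iff φ φ' Φ Ψ hsq) x) = Ψ (QuotientGroup.kerLift φ x) := by
  induction x using QuotientGroup.induction_on with
  | H g => rw [cosetCongr_mk, QuotientGroup.kerLift_mk, QuotientGroup.kerLift_mk, hsq]

end Square

section Transport

variable {G G' Q Q' : Type*}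
  [Group G] [TopologicalSpace G] [IsTopologicalGroup G] [LocallyCompactSpace G] [SecondCountableTopology G] [T2Space G]
  [MeasurableSpace G] [BorelSpace G]
  [Group G'] [TopologicalSpace G'] [IsTopologicalGroup G'] [LocallyCompactSpace G'] [SecondCountableTopology G'] [T2Space G']
  [MeasurableSpace G'] [BorelSpace G']
  [Group Q] [TopologicalSpace Q] [MeasurableSpace Q] [BorelSpace Q]
  [Group Q'] [TopologicalSpace Q'] [MeasurableSpace Q'] [BorelSpace Q']

/-- **`haarPinTransport` — PINS MOVE ALONG COMMUTING SQUARES OF ISOMORPHISMS.**  Let `φ : G →* Q`, `φ' : G' →* Q'` be continuous with closed kernels, `Φ : G ≃* G'` a homeomorphic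
isomorphism and `Ψ : Q ≃* Q'` a continuous isomorphism with `φ' ∘ Φ = Ψ ∘ φ`.  Let `μ` be a right-invariant Haar measure on `G`, `ρ` an inversion- and right-invariant Haar measure on
`ker φ`, and let `μ'`, `ρ'` (Haar measures of the same kind on `G'`, `ker φ'`) be their images: `μ' = Φ_* μ`, `ρ' = (Φ|_{ker φ})_* ρ`.  If `(μ, ρ)` is PINNED over `ν` along `φ` —
`(kerLift φ)_* (μ ∕ ρ) = ν` for the ★ quotient measure `μ ∕ ρ` — then `(μ', ρ')` is pinned over `Ψ_* ν` along `φ'`.  (★ `map_cosetCongr_quotientMeasure` + `kerLift_cosetCongr`.)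
[cite: DeitmarEchterhoff2014, Thm. 1.5.3] [cite: VignerasLNM800, Ch. II §4 («mesures compatibles»)] -/
theorem haarPinTransport
    (φ : G →* Q) (hφ : Continuous φ) (hK : IsClosed ((φ.ker : Subgroup G) : Set G))
    (φ' : G' →* Q') (hφ' : Continuous φ') (hK' : IsClosed ((φ'.ker : Subgroup G') : Set G'))
    (Φ : G ≃* G') (hΦ : Continuous Φ) (hΦs : Continuous Φ.symm) (Ψ : Q ≃* Q') (hΨ : Continuous Ψ)
    (hsq : ∀ g, φ' (Φ g) = Ψ (φ g))
    [iKm : MeasurableSpace φ.ker] [iKb : BorelSpace φ.ker] [MeasurableSpace (G ⧸ φ.ker)] [BorelSpace (G ⧸ φ.ker)]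
    [iKm' : MeasurableSpace φ'.ker] [iKb' : BorelSpace φ'.ker] [MeasurableSpace (G' ⧸ φ'.ker)] [BorelSpace (G' ⧸ φ'.ker)]
    (μ : Measure G) [μ.IsHaarMeasure] [μ.IsMulRightInvariant]
    (ρ : Measure φ.ker) [ρ.IsHaarMeasure] [ρ.IsInvInvariant] [ρ.IsMulRightInvariant]
    (μ' : Measure G') [μ'.IsHaarMeasure] [μ'.IsMulRightInvariant]
    (ρ' : Measure φ'.ker) [ρ'.IsHaarMeasure] [ρ'.IsInvInvariant] [ρ'.IsMulRightInvariant]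
    (hμ' : μ' = Measure.map Φ μ)
    (hρ' : ρ' = Measure.map (fun k : φ.ker => (⟨Φ k, (forall_map_mem_ker_iff φ φ' Φ Ψ hsq k).2 k.2⟩ : φ'.ker)) ρ)
    (ν : Measure Q) (hpin : Measure.map (QuotientGroup.kerLift φ) (quotientMeasure φ.ker ρ hK μ) = ν) :
    Measure.map (QuotientGroup.kerLift φ') (quotientMeasure φ'.ker ρ' hK' μ') = Measure.map Ψ ν := by
  -- the binder-supplied Borel σ-algebras on the kernels ARE the subtype Borel σ-algebras (over which ★ naturality is stated; A5 idiom)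
  obtain rfl : iKm = Subtype.instMeasurableSpace :=
    (@BorelSpace.measurable_eq _ _ iKm iKb).trans (@BorelSpace.measurable_eq (↥φ.ker) _ Subtype.instMeasurableSpace _).symm
  obtain rfl : iKm' = Subtype.instMeasurableSpace :=
    (@BorelSpace.measurable_eq _ _ iKm' iKb').trans (@BorelSpace.measurable_eq (↥φ'.ker) _ Subtype.instMeasurableSpace _).symm
  -- Haar-type side conditions on the kernels (closed subgroups of second countable locally compact groups)
  haveI : LocallyCompactSpace φ.ker := hK.isClosedEmbedding_subtypeVal.locallyCompactSpace
  haveI : LocallyCompactSpace φ'.ker := hK'.isClosedEmbedding_subtypeVal.locallyCompactSpace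
  haveI : IsClosed ((φ.ker : Subgroup G) : Set G) := hK
  haveI : IsClosed ((φ'.ker : Subgroup G') : Set G') := hK'
  -- naturality of the quotient measure along `Φ`
  have hnat := map_cosetCongr_quotientMeasure Φ hΦ hΦs φ.ker φ'.ker (forall_map_mem_ker_iff φ φ' Φ Ψ hsq) ρ ρ' μ μ'
    (hH := hK) (hH' := hK') hρ' hμ'
  -- `kerLift φ' ∘ cosetCongr Φ = Ψ ∘ kerLift φ`
  have hcomp : (QuotientGroup.kerLift φ' : G' ⧸ φ'.ker → Q') ∘ cosetCongr Φ φ.ker φ'.ker (forall_map_mem_ker_iff φ φ' Φ Ψ hsq) =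
      Ψ ∘ QuotientGroup.kerLift φ :=
    funext fun x => kerLift_cosetCongr φ φ' Φ Ψ hsq x
  have hm₁ : Measurable (QuotientGroup.kerLift φ') := (K2E5HaarKerLiftHomeomorph.continuous_kerLift φ' hφ').measurable
  have hm₂ : Measurable (cosetCongr Φ φ.ker φ'.ker (forall_map_mem_ker_iff φ φ' Φ Ψ hsq)) :=
    (continuous_cosetCongr Φ φ.ker φ'.ker (forall_map_mem_ker_iff φ φ' Φ Ψ hsq) hΦ).measurable
  have hm₃ : Measurable (QuotientGroup.kerLift φ) := (K2E5HaarKerLiftHomeomorph.continuous_kerLift φ hφ).measurable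
  rw [← hnat, Measure.map_map hm₁ hm₂, hcomp, ← Measure.map_map hΨ.measurable hm₃, hpin]

end Transport

end Summit.HodgeConjecture.HodgeConjecture.Cruxes.H413.K2E5HaarPinTransport

end
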